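import Literature.Analysis.FluidPDE.HardSphereFlowOrbits
import HarnessLib

/-!
# The group property of the collision-by-collision hard-sphere flow

Fourth layer of the plan for Alexander's theorem on `T^d`
(`Kinetic.HardSphereFlow.nonempty_torus`, reduced in
`Literature.Analysis.FluidPDE.HardSphereFlowConstruction` to five named facts about the explicit
flow `Kinetic.Alexander.flow` and its good set `Γ₀ = Kinetic.Alexander.good`). This file
discharges `Kinetic.Alexander.torusFlow_group` — *`Γ₀` is invariant and `T^t` is a group on
it* (Cercignani–Illner–Pulvirenti 1994 §4.2 p. 65: "the family `{T^t}` is a group: `T⁰ = id`,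
`T^t ∘ T^s = T^{t+s}`"; reversibility (2.3) `T^{-t} = S T^t S`) — for every regular geometry
on a Hausdorff position space, and specialises it to the torus with `0 < ε < 1/2`
(`Kinetic.Alexander.torusFlow_group_holds`).

The proof goes through a **uniqueness / restart principle**: *a hard-sphere trajectory is
reproduced by the collision-by-collision algorithm started at any of its values*
(`IsHardSphereTrajectory.fwdFlow_apply_zero`: `Φ_u (γ 0) = γ u` for `u ≥ 0`;
`fwdFlowLeft_apply_zero`: `Φ_{u⁻} (γ 0) = γ(u⁻)`; `fwdGood_apply_zero`: `γ 0` is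
forward-good), obtained by following the algorithm one collision at a time along the
trajectory (`next_collision`: on a collision-free stretch `(s, T)` ending at a collision time,
`τ(γ s) = T - s`, the exit configuration is the incoming left limit `γ(T⁻)`, it is a simple
incoming collision configuration, and the collision step lands on `γ T`; non-accumulation of
the instants comes from local finiteness of the collision times). Backward in time the same is
applied to the time reversal (`IsHardSphereTrajectory.timeReverse_holds`), with one zero-time
step prepended when the base point is a collision time (`collisionStep_flipVel_apply_zero`,
`FwdGood.of_collisionStep`, `fwdFlowLeft_eq_fwdFlowLeft_collisionStep`). Since orbits of good
points are trajectories (`isHardSphereTrajectory_flow`,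
`Literature.Analysis.FluidPDE.HardSphereFlowOrbits`), invariance of `Γ₀` (`mapsTo_flow_good`)
and the group law (`flow_add_of_mem_good`) follow by reading both sides off the shifted orbit
`s ↦ T^{s+t} z`.

## Mathlib / Literature reuse

`IsHardSphereTrajectory` and its left-limit API (`leftLim_eq_freeFlight`, `leftLim_apply_fst`,
`eq_collidePair_leftLim`, `tendsto_leftLim_nhdsGT`, `timeReverse_holds`) are
`HardSphereDynamics(Proofs)`'; the exit-time and segment kit (`freeExitTime_pos`,
`freeExitTime_le_of_frequently`, `IsSimpleIncomingWith`, `collisionStep_eq_collidePair`,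
`FwdGood.exists_segment(_left)`, `fwdFlow(Left)_eq_of_segment`, `ofReal_sub_toReal_lt`) is
`HardSphereFlowOrbits`'. `Function.leftLim`, `leftLim_eq_of_tendsto`, `tendsto_neg_nhdsLT`,
`ContinuousWithinAt.tendsto_nhdsWithin`, `Finset.min'`, `tsum_eq_zero_add'`,
`Set.infinite_of_injective_forall_mem`, `strictMono_nat_of_lt_succ` are Mathlib's.

## Design choices

* Everything is proved for a regular geometry with `[T2Space X]` (left limits must be unique);
  the torus statement is the last line.
* Forward uniqueness of trajectories (`IsHardSphereTrajectory.unique`, a separate named fact of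
  `HardSphereDynamics` stated for arbitrary geometries) is *not* used or discharged here: for a
  regular geometry it follows from `fwdFlow_apply_zero`, but the general statement needs a
  different (topological) argument.

## References

* C. Cercignani, R. Illner, M. Pulvirenti, *The Mathematical Theory of Dilute Gases*, Springer
  (1994), §4.2 p. 65 (the group `T^t` on `Γ₀`), eq. (2.3) (`T^{-t} = S T^t S`).
* I. Gallagher, L. Saint-Raymond, B. Texier, *From Newton to Boltzmann* (2013), §4.1,
  Def. 4.1.2, Prop. 4.1.1.
* R. K. Alexander, *The infinite hard sphere system*, PhD thesis, UC Berkeley (1975).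
-/

open Set Filter Topology Function
open scoped ENNReal

namespace Literature.Analysis.FluidPDE

noncomputable section

section Kinetic

variable {d : Type*} [Fintype d] {X : Type*} {N : ℕ}

/-! ## Regular geometries have continuous translations -/

/-- In a regular geometry each translation `v ↦ x + v` is continuous (the hypothesis of the
trajectory lemmas of `HardSphereDynamicsProofs`). [folklore] -/
theorem Geometry.IsHardSphereRegular.continuous_translate_left [TopologicalSpace X]
    {G : Geometry d X} {ε : ℝ} (hG : G.IsHardSphereRegular ε) (x : X) :
    Continuous (G.translate x) :=
  hG.continuous_translate.comp (continuous_const.prodMk continuous_id)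

/-! ## Shifting and reversing trajectories -/

namespace IsHardSphereTrajectory

variable [TopologicalSpace X] {G : Geometry d X} {ε : ℝ} {γ : ℝ → Config N d X}

/-- Hard-sphere trajectories are invariant under time shifts: `t ↦ γ (t + c)` is again a
hard-sphere trajectory. [folklore] -/
theorem comp_add_right (h : IsHardSphereTrajectory G ε N γ) (c : ℝ) :
    IsHardSphereTrajectory G ε N fun t => γ (t + c) := by
  refine ⟨fun t => h.mem _, fun a b => ?_, fun i => ?_, fun s t hst hfree => ?_,
    fun t i j hij hc => ?_⟩
  · refine ((h.locFinite (a + c) (b + c)).image fun t => t - c).subset ?_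
    rintro t ⟨ht, hta, htb⟩
    exact ⟨t + c, ⟨ht, by linarith, by linarith⟩, by ring⟩
  · exact (h.pos_continuous i).comp (continuous_add_const c)
  · show γ (t + c) = freeFlight G (t - s) (γ (s + c))
    have hf := h.free (s + c) (t + c) (by linarith) fun σ hσ => ?_
    · rw [hf]
      congr 1
      ring
    · have hσ' := hfree (σ - c) ⟨by linarith [hσ.1], by linarith [hσ.2]⟩
      change ¬ (σ - c + c ∈ collisionTimes G ε γ) at hσ'
      rwa [sub_add_cancel] at hσ'
  · obtain ⟨huniq, zl, hzl, hin, hval⟩ := h.binary (t + c) i j hij hc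
    refine ⟨huniq, zl, ?_, hin, hval⟩
    have htr : Tendsto (fun s : ℝ => s + c) (𝓝[<] t) (𝓝[<] (t + c)) :=
      (continuous_add_const c).continuousWithinAt.tendsto_nhdsWithin fun s hs => by
        have hs' : s < t := hs
        show s + c < t + c
        linarith
    exact hzl.comp htr

/-- The left limits of the time reversal are the flipped values: `(Rγ)(u⁻) = S (γ (-u))`
(right limits of `leftLim γ` are values of `γ`). [folklore] -/
theorem leftLim_timeReverse [T2Space X] (h : IsHardSphereTrajectory G ε N γ)
    (hG : ∀ x : X, Continuous (G.translate x)) (u : ℝ) :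
    leftLim (FluidPDE.timeReverse γ) u = flipVel (γ (-u)) := by
  refine leftLim_eq_of_tendsto ?_
  have h1 : Tendsto (fun w : ℝ => -w) (𝓝[<] u) (𝓝[>] (-u)) := tendsto_neg_nhdsLT
  have h2 := (h.tendsto_leftLim_nhdsGT hG (-u)).comp h1
  exact (continuous_flipVel.tendsto _).comp h2

/-! ## A hard-sphere trajectory is reproduced by the collision-by-collision algorithm -/

/-- The exit time of a value of a hard-sphere trajectory is positive (its contact pairs are
outgoing; regular geometry). [folklore] -/
theorem freeExitTime_apply_pos (hG : G.IsHardSphereRegular ε) (h : IsHardSphereTrajectory G ε N γ)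
    (s : ℝ) : 0 < Alexander.freeExitTime G ε (γ s) := by
  refine Alexander.freeExitTime_pos hG (h.mem s) fun i j hij hc hin => ?_
  obtain ⟨-, zl, -, hzl, hval⟩ := h.binary s i j hij hc
  have hout : IsOutgoing G (γ s) i j := by
    rw [hval]
    exact (isOutgoing_collidePair_iff hij zl).2 hzl
  exact lt_asymm hin hout

/-- **The next collision after `s`**: either the trajectory is collision-free after `s`, or
there is a first collision time `T > s`. [folklore] -/
theorem exists_next_collision (h : IsHardSphereTrajectory G ε N γ) (s : ℝ) :
    (∀ σ, s < σ → σ ∉ collisionTimes G ε γ) ∨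
    ∃ T, s < T ∧ T ∈ collisionTimes G ε γ ∧ ∀ σ ∈ Ioo s T, σ ∉ collisionTimes G ε γ := by
  classical
  by_cases hex : ∃ σ, s < σ ∧ σ ∈ collisionTimes G ε γ
  · right
    obtain ⟨σ, hsσ, hσ⟩ := hex
    set F : Finset ℝ := ((h.locFinite s σ).toFinset).filter fun x => s < x with hF
    have hσF : σ ∈ F :=
      Finset.mem_filter.2 ⟨(Set.Finite.mem_toFinset _).2 ⟨hσ, hsσ.le, le_rfl⟩, hsσ⟩
    have hne : F.Nonempty := ⟨σ, hσF⟩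
    have hmin := Finset.mem_filter.1 (F.min'_mem hne)
    refine ⟨F.min' hne, hmin.2, ((Set.Finite.mem_toFinset _).1 hmin.1).1, fun τ hτ hcol => ?_⟩
    have hτF : τ ∈ F := Finset.mem_filter.2
      ⟨(Set.Finite.mem_toFinset _).2 ⟨hcol, hτ.1.le, hτ.2.le.trans (F.min'_le σ hσF)⟩, hτ.1⟩
    exact (not_lt.2 (F.min'_le τ hτF)) hτ.2
  · exact Or.inl fun σ hσ hcol => hex ⟨σ, hσ, hcol⟩

/-- On a collision-free window `(s, s + u]` the trajectory is the free flight of `γ s`. [folklore] -/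
theorem apply_add_eq_freeFlight (h : IsHardSphereTrajectory G ε N γ) {s u : ℝ} (hu : 0 ≤ u)
    (hfree : ∀ σ ∈ Ioc s (s + u), σ ∉ collisionTimes G ε γ) :
    γ (s + u) = freeFlight G u (γ s) := by
  have hf := h.free s (s + u) (by linarith) hfree
  rwa [add_sub_cancel_left] at hf

/-- If the trajectory is collision-free after `s`, the exit time of `γ s` is infinite. [folklore] -/
theorem freeExitTime_apply_eq_top (h : IsHardSphereTrajectory G ε N γ) {s : ℝ}
    (hfree : ∀ σ, s < σ → σ ∉ collisionTimes G ε γ) :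
    Alexander.freeExitTime G ε (γ s) = ∞ := by
  refine Alexander.freeExitTime_eq_top_iff.2 fun u hu => ?_
  rw [← h.apply_add_eq_freeFlight hu fun σ hσ => hfree σ hσ.1]
  exact h.mem _

/-- At a collision time `T` of a hard-sphere trajectory in a regular geometry, any
configuration with the positions of `γ T` in which the contact pair is incoming is a simple
incoming collision configuration (binary collisions: the contact pair is unique). [folklore] -/
theorem exists_isSimpleIncomingWith (hG : G.IsHardSphereRegular ε)
    (h : IsHardSphereTrajectory G ε N γ) {T : ℝ} {i j : Fin N} (hij : i ≠ j)
    (hcT : γ T ∈ contactSet G N ε i j) {w : Config N d X} (hw : ∀ k, (w k).1 = (γ T k).1)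
    (hin : IsIncoming G w i j) :
    ∃ p, Alexander.IsSimpleIncomingWith G ε w p := by
  obtain ⟨huniq, -⟩ := h.binary T i j hij hcT
  rcases lt_or_gt_of_ne hij with hlt | hlt
  · refine ⟨(i, j), hlt, hin, fun i' j' hij' => ?_⟩
    rw [mem_contactSet_congr_fst hw]
    refine ⟨huniq i' j' hij', fun he => ?_⟩
    rcases Alexander.finsetPair_eq_iff.1 he with ⟨rfl, rfl⟩ | ⟨rfl, rfl⟩
    · exact hcT
    · exact hG.mem_contactSet_comm.1 hcT
  · refine ⟨(j, i), hlt, (hG.isIncoming_comm ?_).2 hin, fun i' j' hij' => ?_⟩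
    · exact ((mem_contactSet_congr_fst hw).2 hcT).2.le
    · rw [mem_contactSet_congr_fst hw]
      refine ⟨fun hc' => by rw [huniq i' j' hij' hc', Finset.pair_comm], fun he => ?_⟩
      rcases Alexander.finsetPair_eq_iff.1 he with ⟨rfl, rfl⟩ | ⟨rfl, rfl⟩
      · exact hG.mem_contactSet_comm.1 hcT
      · exact hcT

/-- **One step of the algorithm along a trajectory**: if `(s, T)` is collision-free and `T` is
a collision time, then the exit time of `γ s` is `T - s`, the exit configuration is the left
limit `γ(T⁻)`, it is a simple incoming collision configuration, and the collision step maps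
`γ s` to `γ T` (regular geometry, Hausdorff position space). [folklore] -/
theorem next_collision [T2Space X] (hG : G.IsHardSphereRegular ε)
    (h : IsHardSphereTrajectory G ε N γ) {s T : ℝ} (hsT : s < T) (hT : T ∈ collisionTimes G ε γ)
    (hfree : ∀ σ ∈ Ioo s T, σ ∉ collisionTimes G ε γ) :
    Alexander.freeExitTime G ε (γ s) = ENNReal.ofReal (T - s) ∧
    leftLim γ T = freeFlight G (T - s) (γ s) ∧
    Alexander.IsSimpleIncoming G ε (freeFlight G (T - s) (γ s)) ∧
    Alexander.collisionStep G ε (γ s) = γ T := by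
  have hG' := hG.continuous_translate_left
  obtain ⟨i, j, hij, hcT⟩ := hT
  have hll : leftLim γ T = freeFlight G (T - s) (γ s) := h.leftLim_eq_freeFlight hG' hsT hfree
  have hwfst : ∀ k, (freeFlight G (T - s) (γ s) k).1 = (γ T k).1 := fun k => by
    rw [← hll]
    exact h.leftLim_apply_fst hG' T k
  have hcw : freeFlight G (T - s) (γ s) ∈ contactSet G N ε i j :=
    (mem_contactSet_congr_fst hwfst).2 hcT
  obtain ⟨hin, hval⟩ := h.eq_collidePair_leftLim hij hcT
  rw [hll] at hin hval
  have hτ : Alexander.freeExitTime G ε (γ s) = ENNReal.ofReal (T - s) := by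
    refine le_antisymm ?_ (Alexander.le_freeExitTime_of_forall_mem fun u hu hult => ?_)
    · refine Alexander.freeExitTime_le_of_frequently (sub_pos.2 hsT).le ?_
      have hev := hG.eventually_freeFlight_not_mem hij hcw hin
      have htr : Tendsto (fun t : ℝ => t - (T - s)) (𝓝[>] (T - s)) (𝓝[>] 0) := by
        have hc : ContinuousWithinAt (fun t : ℝ => t - (T - s)) (Ioi (T - s)) (T - s) :=
          (continuous_sub_right (T - s)).continuousWithinAt
        have h0 : (fun t : ℝ => t - (T - s)) (T - s) = 0 := sub_self _
        rw [← h0]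
        exact hc.tendsto_nhdsWithin fun t ht => by
          have ht' : T - s < t := ht
          show t - (T - s) ∈ Ioi ((T - s) - (T - s))
          rw [sub_self]
          exact sub_pos.2 ht'
      refine ((htr.eventually hev).mono fun t ht => ?_).frequently
      rwa [← freeFlight_add, sub_add_cancel] at ht
    · have hu' : u < T - s := (ENNReal.ofReal_lt_ofReal_iff (sub_pos.2 hsT)).1 hult
      rw [← h.apply_add_eq_freeFlight hu fun σ hσ => hfree σ ⟨hσ.1, by linarith [hσ.2]⟩]
      exact h.mem _
  obtain ⟨p, hp⟩ := h.exists_isSimpleIncomingWith hG hij hcT hwfst hin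
  refine ⟨hτ, hll, ⟨p, hp⟩, ?_⟩
  have hτr : (Alexander.freeExitTime G ε (γ s)).toReal = T - s := by
    rw [hτ, ENNReal.toReal_ofReal (sub_pos.2 hsT).le]
  have hτne : Alexander.freeExitTime G ε (γ s) ≠ ∞ := by
    rw [hτ]
    exact ENNReal.ofReal_ne_top
  have hp' : Alexander.IsSimpleIncomingWith G ε
      (freeFlight G (Alexander.freeExitTime G ε (γ s)).toReal (γ s)) p := by
    rw [hτr]
    exact hp
  rw [Alexander.collisionStep_eq_collidePair hτne hp', hτr, hval]
  exact (hp.collidePair_eq hG (fun _ => rfl) hij hcw).symm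

/-- **Free flight before the exit time**: for `0 ≤ u < τ(γ s)`, `γ (s + u) = S_u (γ s)` and
`s + u` (if `u > 0`) is not a collision time. [folklore] -/
theorem apply_add_eq_freeFlight_of_lt [T2Space X] (hG : G.IsHardSphereRegular ε)
    (h : IsHardSphereTrajectory G ε N γ) {s u : ℝ} (hu : 0 ≤ u)
    (hlt : ENNReal.ofReal u < Alexander.freeExitTime G ε (γ s)) :
    γ (s + u) = freeFlight G u (γ s) ∧ (0 < u → s + u ∉ collisionTimes G ε γ) := by
  rcases h.exists_next_collision s with hfree | ⟨T, hsT, hT, hfree⟩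
  · exact ⟨h.apply_add_eq_freeFlight hu fun σ hσ => hfree σ hσ.1, fun hu0 => hfree _ (by linarith)⟩
  · have hτ := (h.next_collision hG hsT hT hfree).1
    rw [hτ, ENNReal.ofReal_lt_ofReal_iff (sub_pos.2 hsT)] at hlt
    exact ⟨h.apply_add_eq_freeFlight hu fun σ hσ => hfree σ ⟨hσ.1, by linarith [hσ.2]⟩,
      fun hu0 => hfree _ ⟨by linarith, by linarith⟩⟩

/-- **The next collision from a finite exit time**: if `τ(γ s) < ∞` there is a first collision
time `T > s` with `τ(γ s) = T - s`, `γ(T⁻) = S_{T-s} (γ s)` simple incoming, and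
`collisionStep (γ s) = γ T`. [folklore] -/
theorem exists_next_of_ne_top [T2Space X] (hG : G.IsHardSphereRegular ε)
    (h : IsHardSphereTrajectory G ε N γ) {s : ℝ} (hfin : Alexander.freeExitTime G ε (γ s) ≠ ∞) :
    ∃ T, s < T ∧ Alexander.freeExitTime G ε (γ s) = ENNReal.ofReal (T - s) ∧
      T ∈ collisionTimes G ε γ ∧ (∀ σ ∈ Ioo s T, σ ∉ collisionTimes G ε γ) ∧
      leftLim γ T = freeFlight G (T - s) (γ s) ∧
      Alexander.IsSimpleIncoming G ε (freeFlight G (T - s) (γ s)) ∧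
      Alexander.collisionStep G ε (γ s) = γ T := by
  rcases h.exists_next_collision s with hfree | ⟨T, hsT, hT, hfree⟩
  · exact absurd (h.freeExitTime_apply_eq_top hfree) hfin
  · obtain ⟨hτ, hll, hsimple, hstep⟩ := h.next_collision hG hsT hT hfree
    exact ⟨T, hsT, hτ, hT, hfree, hll, hsimple, hstep⟩

/-- Every state of the algorithm started at `γ 0` is a value of the trajectory. [folklore] -/
theorem exists_stateAfter_eq_apply [T2Space X] (hG : G.IsHardSphereRegular ε)
    (h : IsHardSphereTrajectory G ε N γ) (k : ℕ) :
    ∃ t, Alexander.stateAfter G ε (γ 0) k = γ t := by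
  induction k with
  | zero => exact ⟨0, rfl⟩
  | succ k ih =>
    obtain ⟨t, ht⟩ := ih
    rw [Alexander.stateAfter_succ, ht]
    by_cases hfin : Alexander.freeExitTime G ε (γ t) = ∞
    · exact ⟨t, Alexander.collisionStep_of_eq_top hfin⟩
    · obtain ⟨T, -, -, -, -, -, -, hstep⟩ := h.exists_next_of_ne_top hG hfin
      exact ⟨T, hstep⟩

/-- **The algorithm reproduces the collisions**: while the instants are finite, the `k`-th
state of the algorithm started at `γ 0` is `γ (t_k)`, and `t_k` (`k ≥ 1`) is a collision time
of the trajectory. [folklore] -/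
theorem stateAfter_eq_apply [T2Space X] (hG : G.IsHardSphereRegular ε)
    (h : IsHardSphereTrajectory G ε N γ) {k : ℕ}
    (hfin : Alexander.collisionInstant G ε (γ 0) k ≠ ∞) :
    Alexander.stateAfter G ε (γ 0) k = γ (Alexander.collisionInstant G ε (γ 0) k).toReal ∧
      (0 < k → (Alexander.collisionInstant G ε (γ 0) k).toReal ∈ collisionTimes G ε γ) := by
  induction k with
  | zero => simp
  | succ k ih =>
    rw [Alexander.collisionInstant_succ, ENNReal.add_ne_top] at hfin
    obtain ⟨hk, -⟩ := ih hfin.1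
    have hfin2 : Alexander.freeExitTime G ε
        (γ (Alexander.collisionInstant G ε (γ 0) k).toReal) ≠ ∞ := by
      rw [← hk]
      exact hfin.2
    obtain ⟨T, hsT, hτ, hT, -, -, -, hstep⟩ := h.exists_next_of_ne_top hG hfin2
    have htk1 : (Alexander.collisionInstant G ε (γ 0) (k + 1)).toReal = T := by
      rw [Alexander.collisionInstant_succ, ENNReal.toReal_add hfin.1 hfin.2, hk, hτ,
        ENNReal.toReal_ofReal (sub_pos.2 hsT).le]
      ring
    refine ⟨?_, fun _ => ?_⟩
    · rw [Alexander.stateAfter_succ, hk, hstep, htk1]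
    · rw [htk1]
      exact hT

/-- **A trajectory value is forward-good**: the algorithm started at `γ 0` meets only simple
incoming collisions, no grazing touch inside a segment, and its instants do not accumulate
(they are collision times of `γ`, which are locally finite). [folklore] -/
theorem fwdGood_apply_zero [T2Space X] (hG : G.IsHardSphereRegular ε)
    (h : IsHardSphereTrajectory G ε N γ) : Alexander.FwdGood G ε (γ 0) := by
  refine ⟨fun k hk => ?_, fun k t ht hlt i j hij => ?_, ?_⟩
  · obtain ⟨t, hkt⟩ := h.exists_stateAfter_eq_apply hG k
    rw [hkt] at hk ⊢
    obtain ⟨T, hsT, hτ, -, -, -, hsimple, -⟩ := h.exists_next_of_ne_top hG hk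
    rwa [hτ, ENNReal.toReal_ofReal (sub_pos.2 hsT).le]
  · obtain ⟨s, hks⟩ := h.exists_stateAfter_eq_apply hG k
    rw [hks] at hlt ⊢
    obtain ⟨heq, hnot⟩ := h.apply_add_eq_freeFlight_of_lt hG ht.le hlt
    rw [← heq]
    exact fun hc => hnot ht ⟨i, j, hij, hc⟩
  · by_contra hsum
    have hfin : ∀ k, Alexander.collisionInstant G ε (γ 0) k ≠ ∞ := fun k =>
      ne_top_of_le_ne_top hsum (ENNReal.sum_le_tsum (Finset.range k))
    have hpos : ∀ k, 0 < Alexander.freeExitTime G ε (Alexander.stateAfter G ε (γ 0) k) := by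
      intro k
      obtain ⟨t, hkt⟩ := h.exists_stateAfter_eq_apply hG k
      rw [hkt]
      exact h.freeExitTime_apply_pos hG t
    have hmono : StrictMono fun k => (Alexander.collisionInstant G ε (γ 0) k).toReal := by
      refine strictMono_nat_of_lt_succ fun k => ?_
      rw [ENNReal.toReal_lt_toReal (hfin k) (hfin (k + 1)), Alexander.collisionInstant_succ]
      exact ENNReal.lt_add_right (hfin k) (hpos k).ne'
    set S := (∑' k, Alexander.freeExitTime G ε (Alexander.stateAfter G ε (γ 0) k)).toReal
    have hmem : ∀ k, (Alexander.collisionInstant G ε (γ 0) (k + 1)).toReal ∈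
        collisionTimes G ε γ ∩ Icc 0 S := fun k =>
      ⟨(h.stateAfter_eq_apply hG (hfin (k + 1))).2 (Nat.succ_pos k), ENNReal.toReal_nonneg,
        ENNReal.toReal_mono hsum (ENNReal.sum_le_tsum _)⟩
    exact (h.locFinite 0 S).not_infinite (Set.infinite_of_injective_forall_mem
      (fun a b hab => Nat.succ_injective (hmono.injective hab)) hmem)

/-- **The forward flow reproduces the trajectory**: `Φ_u (γ 0) = γ u` for `u ≥ 0`. [folklore] -/
theorem fwdFlow_apply_zero [T2Space X] (hG : G.IsHardSphereRegular ε)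
    (h : IsHardSphereTrajectory G ε N γ) {u : ℝ} (hu : 0 ≤ u) :
    Alexander.fwdFlow G ε (γ 0) u = γ u := by
  have hgood := h.fwdGood_apply_zero hG
  obtain ⟨k, h1, h2⟩ := hgood.exists_segment u
  have hfin : Alexander.collisionInstant G ε (γ 0) k ≠ ∞ :=
    ne_top_of_le_ne_top ENNReal.ofReal_ne_top h1
  obtain ⟨hk, -⟩ := h.stateAfter_eq_apply hG hfin
  rw [Alexander.fwdFlow_eq_of_segment h1 h2, hk]
  have hle : (Alexander.collisionInstant G ε (γ 0) k).toReal ≤ u :=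
    ENNReal.toReal_le_of_le_ofReal hu h1
  have hlt : ENNReal.ofReal (u - (Alexander.collisionInstant G ε (γ 0) k).toReal) <
      Alexander.freeExitTime G ε (γ (Alexander.collisionInstant G ε (γ 0) k).toReal) := by
    rw [← hk]
    rw [Alexander.collisionInstant_succ] at h2
    exact Alexander.ofReal_sub_toReal_lt hu h1 h2
  obtain ⟨heq, -⟩ := h.apply_add_eq_freeFlight_of_lt hG (sub_nonneg.2 hle) hlt
  rw [← heq, add_sub_cancel]

/-- **The left-continuous forward flow reproduces the left limits**: `Φ_{u⁻} (γ 0) = γ(u⁻)`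
for `u > 0`. [folklore] -/
theorem fwdFlowLeft_apply_zero [T2Space X] (hG : G.IsHardSphereRegular ε)
    (h : IsHardSphereTrajectory G ε N γ) {u : ℝ} (hu : 0 < u) :
    Alexander.fwdFlowLeft G ε (γ 0) u = leftLim γ u := by
  have hgood := h.fwdGood_apply_zero hG
  obtain ⟨k, h1, h2⟩ := hgood.exists_segment_left hu
  have hfin : Alexander.collisionInstant G ε (γ 0) k ≠ ∞ := ne_top_of_lt h1
  obtain ⟨hk, -⟩ := h.stateAfter_eq_apply hG hfin
  rw [Alexander.fwdFlowLeft_eq_of_segment (Or.inl h1) h2, hk]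
  set tk := (Alexander.collisionInstant G ε (γ 0) k).toReal with htk
  have hlt : tk < u := ENNReal.toReal_lt_of_lt_ofReal h1
  refine (h.leftLim_eq_freeFlight hG.continuous_translate_left hlt fun σ hσ => ?_).symm
  have hσ0 : 0 ≤ σ := ENNReal.toReal_nonneg.trans hσ.1.le
  have h1σ : Alexander.collisionInstant G ε (γ 0) k ≤ ENNReal.ofReal σ := by
    rw [← ENNReal.ofReal_toReal hfin]
    exact ENNReal.ofReal_le_ofReal hσ.1.le
  have hσlt : ENNReal.ofReal (σ - tk) < Alexander.freeExitTime G ε (γ tk) := by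
    rw [htk, ← hk]
    have h2' : ENNReal.ofReal σ < Alexander.collisionInstant G ε (γ 0) (k + 1) :=
      lt_of_lt_of_le ((ENNReal.ofReal_lt_ofReal_iff hu).2 hσ.2) h2
    rw [Alexander.collisionInstant_succ] at h2'
    exact Alexander.ofReal_sub_toReal_lt hσ0 h1σ h2'
  obtain ⟨-, hnot⟩ := h.apply_add_eq_freeFlight_of_lt hG (sub_pos.2 hσ.1).le hσlt
  have hσ' := hnot (sub_pos.2 hσ.1)
  rwa [add_sub_cancel] at hσ'

end IsHardSphereTrajectory

/-! ## An initial instant collision: prepending a zero-time step -/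

namespace Alexander

variable {G : Geometry d X} {ε : ℝ} {y : Config N d X}

/-- `z_1 = T z`. [folklore] -/
theorem stateAfter_one (y : Config N d X) : stateAfter G ε y 1 = collisionStep G ε y :=
  stateAfter_succ y 0

/-- The states of the dynamics restarted after the first step. [folklore] -/
theorem stateAfter_succ_eq_stateAfter_collisionStep (y : Config N d X) (k : ℕ) :
    stateAfter G ε y (k + 1) = stateAfter G ε (collisionStep G ε y) k := by
  rw [add_comm, ← stateAfter_stateAfter y 1 k, stateAfter_one]

/-- **Forward-goodness propagates backward through one step**: if the first free flight of `y`
ends in a simple incoming collision configuration, meets no contact strictly inside, and the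
next state `T y` is forward-good, then `y` is forward-good. [folklore] -/
theorem FwdGood.of_collisionStep
    (hsimple : IsSimpleIncoming G ε (freeFlight G (freeExitTime G ε y).toReal y))
    (hnc : ∀ t : ℝ, 0 < t → ENNReal.ofReal t < freeExitTime G ε y →
      ∀ i j : Fin N, i ≠ j → freeFlight G t y ∉ contactSet G N ε i j)
    (hnext : FwdGood G ε (collisionStep G ε y)) : FwdGood G ε y := by
  refine ⟨fun k => ?_, fun k => ?_, ?_⟩
  · cases k with
    | zero => exact fun _ => hsimple
    | succ k =>
      rw [stateAfter_succ_eq_stateAfter_collisionStep]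
      exact hnext.1 k
  · cases k with
    | zero => exact hnc
    | succ k =>
      rw [stateAfter_succ_eq_stateAfter_collisionStep]
      exact hnext.2.1 k
  · rw [tsum_eq_zero_add' ENNReal.summable]
    simp only [stateAfter_succ_eq_stateAfter_collisionStep, stateAfter_zero]
    rw [hnext.2.2, add_top]

/-- **A zero-time first step does not change the left-continuous forward flow** at positive
times: if `τ(y) = 0` then `Φ_{u⁻} y = Φ_{u⁻} (T y)` for `u > 0` (the instants of `y` are
`0, 0, t_1(Ty), t_2(Ty), …`; non-accumulation of the instants of `T y` is used to identify the
segments). [folklore] -/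
theorem fwdFlowLeft_eq_fwdFlowLeft_collisionStep (hτ : freeExitTime G ε y = 0)
    (hnext : FwdGood G ε (collisionStep G ε y)) {u : ℝ} (hu : 0 < u) :
    fwdFlowLeft G ε y u = fwdFlowLeft G ε (collisionStep G ε y) u := by
  have hinst : ∀ k, collisionInstant G ε y (k + 1) = collisionInstant G ε (collisionStep G ε y) k := by
    intro k
    induction k with
    | zero => rw [collisionInstant_one, hτ, collisionInstant_zero]
    | succ k ih =>
      rw [collisionInstant_succ, ih, stateAfter_succ_eq_stateAfter_collisionStep,
        ← collisionInstant_succ]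
  obtain ⟨k, h1, h2⟩ := hnext.exists_segment_left hu
  rw [fwdFlowLeft_eq_of_segment (Or.inl h1) h2,
    fwdFlowLeft_eq_of_segment (k := k + 1) (Or.inl (by rwa [hinst])) (by rwa [hinst]), hinst,
    stateAfter_succ_eq_stateAfter_collisionStep]

end Alexander

/-! ## The flipped value of a trajectory: backward goodness and the backward flow -/

namespace IsHardSphereTrajectory

variable [TopologicalSpace X] [T2Space X] {G : Geometry d X} {ε : ℝ} {γ : ℝ → Config N d X}

/-- **At a collision time the flipped value collides instantly back to the flipped left limit**:
if `0` is a collision time of `γ` then `S (γ 0)` has zero exit time, is a simple incoming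
collision configuration, and its collision step is `S (γ(0⁻))` (the reflection law commutes
with the velocity flip and is an involution). [folklore] -/
theorem collisionStep_flipVel_apply_zero (hG : G.IsHardSphereRegular ε)
    (h : IsHardSphereTrajectory G ε N γ) (h0 : (0 : ℝ) ∈ collisionTimes G ε γ) :
    Alexander.freeExitTime G ε (flipVel (γ 0)) = 0 ∧
    Alexander.IsSimpleIncoming G ε (flipVel (γ 0)) ∧
    Alexander.collisionStep G ε (flipVel (γ 0)) = flipVel (leftLim γ 0) := by
  obtain ⟨i, j, hij, hc⟩ := h0
  obtain ⟨hin, hval⟩ := h.eq_collidePair_leftLim hij hc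
  have hc' : flipVel (γ 0) ∈ contactSet G N ε i j := (flipVel_mem_contactSet_iff _).2 hc
  have hin' : IsIncoming G (flipVel (γ 0)) i j := by
    rw [isIncoming_flipVel_iff, hval]
    exact (isOutgoing_collidePair_iff hij _).2 hin
  have hτ0 : Alexander.freeExitTime G ε (flipVel (γ 0)) = 0 :=
    Alexander.freeExitTime_eq_zero_of_isIncoming hG hij hc' hin'
  obtain ⟨p, hp⟩ := h.exists_isSimpleIncomingWith hG hij hc (w := flipVel (γ 0)) (fun _ => rfl) hin'
  refine ⟨hτ0, ⟨p, hp⟩, ?_⟩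
  have hp0 : Alexander.IsSimpleIncomingWith G ε
      (freeFlight G (Alexander.freeExitTime G ε (flipVel (γ 0))).toReal (flipVel (γ 0))) p := by
    rw [hτ0, ENNReal.toReal_zero, freeFlight_zero]
    exact hp
  have hτne : Alexander.freeExitTime G ε (flipVel (γ 0)) ≠ ∞ := by
    rw [hτ0]
    exact ENNReal.zero_ne_top
  rw [Alexander.collisionStep_eq_collidePair hτne hp0, hτ0, ENNReal.toReal_zero, freeFlight_zero,
    ← hp.collidePair_eq hG (fun _ => rfl) hij hc', collidePair_flipVel hij, hval,
    collidePair_collidePair hij]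

/-- **The flipped value of a trajectory is forward-good** (i.e. the value is backward-good):
by reversibility (`timeReverse_holds`) the time reversal is a trajectory through
`S (γ(0⁻))`, which is forward-good; if `0` is a collision time one zero-time step is prepended
(`FwdGood.of_collisionStep`). [folklore] -/
theorem fwdGood_flipVel_apply_zero (hG : G.IsHardSphereRegular ε)
    (h : IsHardSphereTrajectory G ε N γ) : Alexander.FwdGood G ε (flipVel (γ 0)) := by
  have hρ : IsHardSphereTrajectory G ε N (FluidPDE.timeReverse γ) :=
    IsHardSphereTrajectory.timeReverse_holds hG.continuous_translate_left h
  have hgoodρ := hρ.fwdGood_apply_zero hG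
  rw [timeReverse_apply, neg_zero] at hgoodρ
  by_cases hcol : (0 : ℝ) ∈ collisionTimes G ε γ
  · obtain ⟨hτ0, hsimple, hstep⟩ := h.collisionStep_flipVel_apply_zero hG hcol
    refine Alexander.FwdGood.of_collisionStep ?_ ?_ ?_
    · rw [hτ0, ENNReal.toReal_zero, freeFlight_zero]
      exact hsimple
    · intro t _ hlt
      rw [hτ0] at hlt
      exact absurd hlt ENNReal.not_lt_zero
    · rw [hstep]
      exact hgoodρ
  · rwa [h.leftLim_eq_of_not_mem hG.continuous_translate_left hcol] at hgoodρ

/-- **The backward flow reproduces the trajectory**: `Φ_{u⁻} (S (γ 0)) = S (γ (-u))` for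
`u > 0`, i.e. `S Φ_{u⁻} S (γ 0) = γ (-u)` (CIP 1994 (2.3)). [cite: CIP1994, §4.2 (2.3)] -/
theorem fwdFlowLeft_flipVel_apply_zero (hG : G.IsHardSphereRegular ε)
    (h : IsHardSphereTrajectory G ε N γ) {u : ℝ} (hu : 0 < u) :
    Alexander.fwdFlowLeft G ε (flipVel (γ 0)) u = flipVel (γ (-u)) := by
  have hG' := hG.continuous_translate_left
  have hρ : IsHardSphereTrajectory G ε N (FluidPDE.timeReverse γ) :=
    IsHardSphereTrajectory.timeReverse_holds hG' h
  have hL := hρ.fwdFlowLeft_apply_zero hG hu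
  rw [h.leftLim_timeReverse hG', timeReverse_apply, neg_zero] at hL
  by_cases hcol : (0 : ℝ) ∈ collisionTimes G ε γ
  · obtain ⟨hτ0, -, hstep⟩ := h.collisionStep_flipVel_apply_zero hG hcol
    have hgoodρ := hρ.fwdGood_apply_zero hG
    rw [timeReverse_apply, neg_zero, ← hstep] at hgoodρ
    rw [Alexander.fwdFlowLeft_eq_fwdFlowLeft_collisionStep hτ0 hgoodρ hu, hstep, hL]
  · rwa [h.leftLim_eq_of_not_mem hG' hcol] at hL

end IsHardSphereTrajectory

/-! ## The group property on the good set -/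

namespace Alexander

variable [TopologicalSpace X] [T2Space X] {G : Geometry d X} {ε : ℝ}

/-- **The good set is invariant**: `T^t` maps `Γ₀` to itself (regular geometry, Hausdorff
position space). The value `T^t z` is a value of the hard-sphere trajectory `s ↦ T^{s+t} z`,
hence lies in the domain with outgoing, unique contact pairs, is forward-good, and its flip is
forward-good. [cite: CIP1994, §4.2 p. 65] -/
theorem mapsTo_flow_good (hG : G.IsHardSphereRegular ε) (t : ℝ) :
    MapsTo (flow (N := N) G ε t) (good G ε) (good G ε) := by
  intro z hz
  have hΓt := (isHardSphereTrajectory_flow hG hz).comp_add_right t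
  have hmem := hΓt.mem 0
  have hgood := hΓt.fwdGood_apply_zero hG
  have hgood' := hΓt.fwdGood_flipVel_apply_zero hG
  simp only [zero_add] at hmem hgood hgood'
  refine ⟨hmem, fun i j hij hc => ?_, hgood, hgood'⟩
  have hc0 : (fun s => flow G ε (s + t) z) 0 ∈ contactSet G N ε i j := by simpa using hc
  obtain ⟨huniq, zl, -, hin, hval⟩ := hΓt.binary 0 i j hij hc0
  simp only [zero_add] at huniq hval
  refine ⟨?_, huniq⟩
  rw [hval]
  exact (isOutgoing_collidePair_iff hij zl).2 hin

/-- **The group law on the good set**: `T^{s+t} z = T^s (T^t z)` for `z ∈ Γ₀` (regular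
geometry, Hausdorff position space): both sides are read off the trajectory `s ↦ T^{s+t} z`
through `T^t z`, forward by `fwdFlow_apply_zero` and backward by
`fwdFlowLeft_flipVel_apply_zero`. [cite: CIP1994, §4.2 p. 65] -/
theorem flow_add_of_mem_good (hG : G.IsHardSphereRegular ε) (s t : ℝ) {z : Config N d X}
    (hz : z ∈ good G ε) : flow G ε (s + t) z = flow G ε s (flow G ε t z) := by
  have hΓt := (isHardSphereTrajectory_flow hG hz).comp_add_right t
  rcases le_or_gt 0 s with hs | hs
  · have h1 := hΓt.fwdFlow_apply_zero hG hs
    simp only [zero_add] at h1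
    rw [flow_of_nonneg hs, h1]
  · have h2 := hΓt.fwdFlowLeft_flipVel_apply_zero hG (neg_pos.2 hs)
    simp only [zero_add, neg_neg] at h2
    rw [flow_of_neg hs, h2, flipVel_flipVel]

/-- **Discharge of `torusFlow_group`**: on the flat torus with `0 < ε < 1/2` the constructed
flow is a group on its invariant good set: `T^t Γ₀ ⊆ Γ₀`, `T⁰ = id` and
`T^{s+t} = T^s ∘ T^t` on `Γ₀` (CIP 1994 §4.2 p. 65). [cite: CIP1994, §4.2 p. 65] -/
theorem torusFlow_group_holds : torusFlow_group (d := d) := by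
  intro ε _hε hε' N
  have hG := Torus.isHardSphereRegular_geometry (d := d) hε'
  exact ⟨fun t => mapsTo_flow_good hG t, fun z hz => flow_zero_of_mem_good hG hz,
    fun s t z hz => flow_add_of_mem_good hG s t hz⟩

end Alexander

end Kinetic

end

end Literature.Analysis.FluidPDE
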